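import Summits.AtomisticToContinuum.BoseEinsteinCondensation.Theses.BECHusimiAmplitudeGas
import Summits.AtomisticToContinuum.BoseEinsteinCondensation.Theorems.BECHusimiAmplitudeGasFastFractionBound
import Literature.Barriers.AtomisticToContinuum.KineticGapLengthScalesFreeGas

/-!
# `PeriodicBECNonneg` from the Husimi items (route BECHusimiAmplitudeGas)

Conditional reduction of the node `PeriodicBECNonneg` (item stmt-AtomisticToContinuum-11996) to the
three upstream items `HusimiConcentration`, `TiltStability`, `FastFractionBound` of the same route:
the `RatioToCondensate` glue with condensate fraction `c = 1/4`
(`periodicBECNonneg_of_husimi`, `ratioToCondensate_holds`).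

With `C` from `TiltStability` take `η = 1/(4C)`, `M = max 1 M₀(η)`, `ρ₀ = min` of the three
thresholds, intersect the three eventual-`N` sets, `δ = min` of the three slacks; then
`(1 + N/2)·D ≤ Num ≤ (n₀ + C·n_fast + 1)·D ≤ (n₀ + N/4 + 1)·D` with `0 < D < ∞` gives `n₀ ≥ N/4`.

Position of the node: it is implied by the unsigned periodic-BEC statement (the antecedent of
`BoundaryTransferWeak`, stmt-AtomisticToContinuum-0826's body) by forgetting the sign condition
(`periodicBECNonneg_of_periodicBEC`), and its `v = 0` instance holds in the tree
(`periodicBECNonneg_body_free`, from the barrier file's `periodicBEC_antecedent_free`: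
Poincaré on every slice, `δ_N = κN/L_N²`, `c = 1/2`).
-/

namespace Summit.AtomisticToContinuum.BoseEinsteinCondensation.Theorems

open Summit.AtomisticToContinuum.BoseEinsteinCondensation.Theses.BECHusimiAmplitudeGas
open Literature.MathematicalPhysics.QuantumManyBody.BoseGas
open Filter
open scoped ENNReal

/-- The `ℝ≥0∞` arithmetic of the ratio-to-condensate step: from
`ofReal (1 + N/2) · D ≤ Num ≤ (n₀ + ofReal C · n_fast + 1) · D`, `0 < D < ∞` and
`n_fast ≤ ofReal (N/(4C))` conclude `ofReal (N/4) ≤ n₀`. [folklore] -/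
theorem ratioToCondensate_arith {D Num n₀ nfast : ℝ≥0∞} {C η : ℝ} {N : ℕ} (hC : 0 < C)
    (hη : η = 1 / (4 * C)) (hD0 : D ≠ 0) (hDtop : D ≠ ⊤)
    (hlow : ENNReal.ofReal (1 + (N : ℝ) / 2) * D ≤ Num)
    (hup : Num ≤ (n₀ + ENNReal.ofReal C * nfast + 1) * D)
    (hfast : nfast ≤ ENNReal.ofReal (η * N)) :
    ENNReal.ofReal (1 / 4 * N) ≤ n₀ := by
  have h1 : ENNReal.ofReal (1 + (N : ℝ) / 2) ≤ n₀ + ENNReal.ofReal C * nfast + 1 :=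
    (ENNReal.mul_le_mul_iff_left hD0 hDtop).1 (hlow.trans hup)
  have h2 : ENNReal.ofReal C * nfast ≤ ENNReal.ofReal (1 / 4 * N) := by
    calc ENNReal.ofReal C * nfast ≤ ENNReal.ofReal C * ENNReal.ofReal (η * N) := by gcongr
      _ = ENNReal.ofReal (C * (η * N)) := (ENNReal.ofReal_mul hC.le).symm
      _ = ENNReal.ofReal (1 / 4 * N) := by
          congr 1
          rw [hη]
          field_simp
  have h3 : ENNReal.ofReal (1 + (N : ℝ) / 2) =
      ENNReal.ofReal (1 / 4 * N) + (ENNReal.ofReal (1 / 4 * N) + 1) := by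
    have hq : (0 : ℝ) ≤ 1 / 4 * N := by positivity
    rw [← ENNReal.ofReal_one, ← ENNReal.ofReal_add hq zero_le_one,
      ← ENNReal.ofReal_add hq (by positivity)]
    congr 1
    ring
  have h4 : ENNReal.ofReal (1 / 4 * N) + (ENNReal.ofReal (1 / 4 * N) + 1) ≤
      n₀ + (ENNReal.ofReal (1 / 4 * N) + 1) := by
    calc ENNReal.ofReal (1 / 4 * N) + (ENNReal.ofReal (1 / 4 * N) + 1)
        = ENNReal.ofReal (1 + (N : ℝ) / 2) := h3.symm
      _ ≤ n₀ + ENNReal.ofReal C * nfast + 1 := h1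
      _ ≤ n₀ + ENNReal.ofReal (1 / 4 * N) + 1 := by gcongr
      _ = n₀ + (ENNReal.ofReal (1 / 4 * N) + 1) := by rw [add_assoc]
  exact ENNReal.le_of_add_le_add_right
    (ENNReal.add_ne_top.2 ⟨ENNReal.ofReal_ne_top, ENNReal.one_ne_top⟩) h4

/-- **Ratio to condensate.** The node `PeriodicBECNonneg` (constant-mode BEC with fraction
`c = 1/4` for nonnegative periodic near-minimisers) follows from `HusimiConcentration`,
`TiltStability` and `FastFractionBound`: with `C` from `TiltStability` take `η = 1/(4C)`,
`M = max 1 (M₀ η)`, the least of the three density thresholds, the intersection of the three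
eventual-`N` sets and the least of the three slacks `δ`; then
`(1 + N/2)·D ≤ Num ≤ (n₀ + C·ηN + 1)·D` with `0 < D < ∞` gives `n₀ ≥ N/4`. [folklore] -/
theorem periodicBECNonneg_of_husimi (h₁ : HusimiConcentration) (h₂ : TiltStability)
    (h₃ : FastFractionBound) : PeriodicBECNonneg := by
  intro v hv
  obtain ⟨C, hC, hT⟩ := h₂ v hv
  obtain ⟨M₀, hF⟩ := h₃ v hv (1 / (4 * C)) (by positivity)
  obtain ⟨ρ₁, hρ₁, hH⟩ := h₁ v hv (max 1 M₀) (le_max_left _ _)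
  obtain ⟨ρ₂, hρ₂, hT'⟩ := hT (max 1 M₀) (le_max_left _ _)
  obtain ⟨ρ₃, hρ₃, hF'⟩ := hF (max 1 M₀) (le_max_right _ _)
  refine ⟨min ρ₁ (min ρ₂ ρ₃), lt_min hρ₁ (lt_min hρ₂ hρ₃), fun ρ hρ hρlt => ?_⟩
  have hρlt₁ : ρ < ρ₁ := hρlt.trans_le (min_le_left _ _)
  have hρlt₂ : ρ < ρ₂ := hρlt.trans_le ((min_le_right _ _).trans (min_le_left _ _))
  have hρlt₃ : ρ < ρ₃ := hρlt.trans_le ((min_le_right _ _).trans (min_le_right _ _))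
  refine ⟨1 / 4, by norm_num, ?_⟩
  filter_upwards [hH ρ hρ hρlt₁, hT' ρ hρ hρlt₂, hF' ρ hρ hρlt₃] with N hN₁ hN₂ hN₃
  obtain ⟨δ₁, hδ₁, hN₁⟩ := hN₁
  obtain ⟨δ₂, hδ₂, hN₂⟩ := hN₂
  obtain ⟨δ₃, hδ₃, hN₃⟩ := hN₃
  refine ⟨min δ₁ (min δ₂ δ₃), lt_min hδ₁ (lt_min hδ₂ hδ₃), fun Ψ hE hpos => ?_⟩
  have hE₁ := hN₁ Ψ (hE.trans (add_le_add le_rfl (min_le_left _ _))) hpos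
  have hE₂ := hN₂ Ψ (hE.trans (add_le_add le_rfl ((min_le_right _ _).trans (min_le_left _ _))))
    hpos
  have hE₃ := hN₃ Ψ (hE.trans (add_le_add le_rfl ((min_le_right _ _).trans (min_le_right _ _))))
  obtain ⟨hD0, hDtop, hlow⟩ := hE₁
  exact ratioToCondensate_arith hC rfl hD0 hDtop hlow hE₂ hE₃

/-- The route item `RatioToCondensate` (stmt-AtomisticToContinuum-11997) verbatim:
`HusimiConcentration → TiltStability → FastFractionBound → PeriodicBECNonneg`. [folklore] -/
theorem ratioToCondensate_holds : RatioToCondensate :=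
  periodicBECNonneg_of_husimi

/-- **Forgetting the sign.** The unsigned periodic-BEC statement (constant-mode BEC of ALL periodic
`δ`-near-minimisers at small density — the antecedent of `BoundaryTransferWeak`, quantified over
the admissible `v`) implies the node `PeriodicBECNonneg` (the same for nonnegative
near-minimisers): the sign hypothesis is simply dropped. The converse is the route item
`PositivityReduction`. [folklore] -/
theorem periodicBECNonneg_of_periodicBEC
    (h : ∀ v : ℝ → ℝ≥0∞, IsRepulsiveFiniteRange v → ∃ ρ₀ : ℝ, 0 < ρ₀ ∧ ∀ ρ : ℝ, 0 < ρ → ρ < ρ₀ →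
      ∃ c : ℝ, 0 < c ∧ ∀ᶠ N : ℕ in atTop, ∃ δ : ℝ≥0∞, 0 < δ ∧
        ∀ Ψ : PeriodicTrialState N (sideLength ρ N),
          periodicEnergy v Ψ ≤ periodicGroundStateEnergy v N (sideLength ρ N) + δ →
            ENNReal.ofReal (c * N) ≤ condensateOccupation N (sideLength ρ N) Ψ.ψ) :
    PeriodicBECNonneg := by
  intro v hv
  obtain ⟨ρ₀, hρ₀, h⟩ := h v hv
  refine ⟨ρ₀, hρ₀, fun ρ hρ hρlt => ?_⟩
  obtain ⟨c, hc, hN⟩ := h ρ hρ hρlt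
  refine ⟨c, hc, ?_⟩
  filter_upwards [hN] with N ⟨δ, hδ, hΨ⟩
  exact ⟨δ, hδ, fun Ψ hE _ => hΨ Ψ hE⟩

/-- **The free gas.** The body of `PeriodicBECNonneg` at `v = 0` holds (with `ρ₀ = 1`, `c = 1/2`,
`δ_N = κN/L_N²`): Poincaré on every particle slice of the torus gives
`N ≤ ⟨Ψ, n₀Ψ⟩ + C L² ⟨Ψ, -ΔΨ⟩` and `E₀^per(0) = 0` (`periodicBEC_antecedent_free` of the
kinetic-gap barrier file); the sign hypothesis is not needed. [folklore] -/
theorem periodicBECNonneg_body_free :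
    ∃ ρ₀ : ℝ, 0 < ρ₀ ∧ ∀ ρ : ℝ, 0 < ρ → ρ < ρ₀ → ∃ c : ℝ, 0 < c ∧ ∀ᶠ N : ℕ in atTop,
      ∃ δ : ℝ≥0∞, 0 < δ ∧ ∀ Ψ : PeriodicTrialState N (sideLength ρ N),
        periodicEnergy 0 Ψ ≤ periodicGroundStateEnergy 0 N (sideLength ρ N) + δ →
          (∀ X, Ψ.ψ X = ((‖Ψ.ψ X‖ : ℝ) : ℂ)) →
          ENNReal.ofReal (c * N) ≤ condensateOccupation N (sideLength ρ N) Ψ.ψ := by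
  obtain ⟨ρ₀, hρ₀, h⟩ :=
    Literature.Barriers.AtomisticToContinuum.BoseGas.periodicBEC_antecedent_free
  refine ⟨ρ₀, hρ₀, fun ρ hρ hρlt => ?_⟩
  obtain ⟨c, hc, hN⟩ := h ρ hρ hρlt
  refine ⟨c, hc, ?_⟩
  filter_upwards [hN] with N ⟨δ, hδ, hΨ⟩
  exact ⟨δ, hδ, fun Ψ hE _ => hΨ Ψ hE⟩

/-- **The node modulo the two cruxes.** With `FastFractionBound` proved in the tree
(`fastFractionBound_proof`, item stmt-AtomisticToContinuum-11993), `PeriodicBECNonneg` follows from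
`HusimiConcentration` (stmt-AtomisticToContinuum-11994) and `TiltStability`
(stmt-AtomisticToContinuum-11992) alone, with condensate fraction `c = 1/4`. [folklore] -/
theorem periodicBECNonneg_of_husimi_tilt (h₁ : HusimiConcentration) (h₂ : TiltStability) :
    PeriodicBECNonneg :=
  periodicBECNonneg_of_husimi h₁ h₂ fastFractionBound_proof

end Summit.AtomisticToContinuum.BoseEinsteinCondensation.Theorems
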